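import Summits.BirchSwinnertonDyer.Rank1Residual.Supersingular.MazurTateValuation
import Summits.BirchSwinnertonDyer.Rank1Residual.Additive.OmegaDvdMazurTateAddv
import HarnessLib

/-!
# LEMMA A: the valuation of `G(ζ − 1)` when `ω_m ∣ G` — `v_p(G(ζ − 1)) = μ(G) + λ(G)/φ(pⁿ⁺¹)` WITHOUT
# the hypothesis `λ(G) < φ(pⁿ⁺¹)`; at an ADDITIVE prime (`ω_k ∣ θ_{k+1}`, Doyon–Lei) the Birch sums of a
# Mazur–Tate element read `(μ, λ)` EXACTLY at every layer
# (cell `b2b-bsdres`, lane CLASS-CLOSURE; class-agnostic kernel support for the O5/O6 Mazur–Tate censuses;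
# seat cc-typer-5 GEN 3 = O5/O6 typer of record, answering o6-r1 GEN 3's ask A-O6-T3 (e) / (G3-12) (b)
# "`ordChi_mazurTate_eq_of_omegaDvd`"; THEOREMS ONLY)

HONEST FRAMING (run/shared/lean/b2b/bsd-rank1-residual/, verbatim in every file): the goal of the
cell is to DELETE the COMBINATION-SHAPED residual classes of the Birch–Swinnerton-Dyer formula for
ALL analytic-rank `≤ 1` elliptic curves over `ℚ` — "full BSD formula for every rank `≤ 1` curve in
class `C`" assembled STRICTLY from published theorems — so that the rank-`≤ 1` remainder becomes
exactly the CONSTRUCTION-SHAPED classes, which are TYPED (missing-input `Prop`s), NOT attempted.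
This is not "finishing BSD". THEOREMS ONLY (pure `p`-adic algebra + one reading of the tree's
Mazur–Tate element); no definition, no named fact, no `sorry`; nothing about any curve is asserted;
nothing booked; no label changes; census output stays EVIDENCE.

## What this file proves

The tree's VALUATION THEOREM (`Iwasawa/LambdaInvariantValuation{,Layer,Twisted}.lean`) reads, for
`G ∈ Λ ∖ {0}` and `ζ ∈ ℂ_p` of order `pⁿ⁺¹`: `|G(ζ − 1)|^{φ(pⁿ⁺¹)} = p^{−(φ(pⁿ⁺¹)·μ(G) + λ(G))}`
PROVIDED `λ(G) < φ(pⁿ⁺¹)` (else only "`μ ≥ 1 ∨ λ ≥ φ`", ENGINE T's "undetermined"). At an ADDITIVE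
prime the Mazur–Tate elements satisfy `ω_k ∣ θ_{k+1}` (Doyon–Lei Lemma 5.2 / Cor. 5.3; tree node
`Additive.OmegaDvdMazurTateOfAddv`), so `λ(θ_{k+1}) ≥ pᵏ` and on the O5/O6 rows `λ ≥ φ(pᵏ⁺¹)` is the
RULE. o6-r1 GEN 3's LEMMA A (O6-GEN3 §1, TARGETS (G3-12) (b)): the divisibility itself repairs this —
`G = ω_m · U` with `λ(U) < φ(pⁿ⁺¹)` gives `|G(ζ − 1)| = |ζ^{p^m} − 1| · p^{−μ(U)} |ζ − 1|^{λ(U)}`,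
`|ζ^{p^m} − 1|^{φ(pⁿ⁺¹)} = p^{−p^m}`, `μ(G) = μ(U)`, `λ(G) = p^m + λ(U)`: the SAME formula with NO
restriction beyond `λ(G) < p^m + φ(pⁿ⁺¹)`, AUTOMATIC for `θ_{k+1} = ω_k · U` (`deg U < φ(pᵏ⁺¹)`).

* §1 `ω_m = (1+T)^{p^m} − 1` in `Λ`: non-zero, `μ(ω_m) = 0`, `λ(ω_m) = p^m`
  (`red ω_m = T^{p^m}`, tree `Supersingular.red_toIwasawa_cyclotomicOmega`); its value at `z` is
  `(z + 1)^{p^m} − 1`; `λ` of (the image of) a polynomial is at most its degree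
  (`lam_coe_le_natDegree`).
* §2 `|ζ^{p^m} − 1|^{φ(pⁿ⁺¹)} = p^{−p^m}` for `ζ` of order `pⁿ⁺¹`, `m ≤ n`.
* §3 **LEMMA A (kernel form)**: `G = ω_m · U`, `U ≠ 0`, `m ≤ n`, `λ(U) < φ(pⁿ⁺¹)` ⇒
  `|G(ζ − 1)|^{φ(pⁿ⁺¹)} = p^{−(φ(pⁿ⁺¹)·μ(G) + λ(G))}` (`norm_tsum_pow_totient_eq_of_eq_omega_mul`);
  equivalently with the hypothesis `λ(G) < p^m + φ(pⁿ⁺¹)` (`…_of_eq_omega_mul_of_lam_lt`).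
* §4 **Mazur–Tate elements**: `Θ ≠ 0` an integral model of `θ_{k+1}` (`ι Θ = θ_{k+1}`) with
  `ω_k ∣ θ_{k+1}` in `ℚ[T]` ⇒ `Θ = ω_k · U` in `Λ` with `λ(U) < φ(pᵏ⁺¹)`
  (`exists_eq_omega_mul_of_omega_dvd_mazurTate`: truncation to a polynomial of degree `< pᵏ⁺¹`,
  monic division by `ω_k` descended from `ℚ_p[T]` to `ℤ_p[T]`), hence for EVERY primitive even
  `p`-power-order `χ` of conductor `p^{k+1+e₀}`:
  **`|∑_a χ(a)[a/p^{k+1+e₀}]⁺_f|^{φ(pᵏ⁺¹)} = p^{−(φ(pᵏ⁺¹)·μ(Θ) + λ(Θ))}`** with NO hypothesis on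
  `λ(Θ)` (`mazurTate_norm_ratTwistedSymbolSum_pow_totient_eq_of_omega_dvd`) — o6-r1's
  `ordChi_mazurTate_eq_of_omegaDvd`: `ord_p χ(θ) = μ(θ) + λ(θ)/φ(pᵏ⁺¹)`, `A_k = μ_k φ(3^k) + λ_k`
  EXACTLY (census check 5 425/5 425 on cc-eng-3's ENG-D tables before this proof).
* §5 at an ADDITIVE prime of `E = W` (`Addv W p`), granted the Doyon–Lei node
  `Additive.OmegaDvdMazurTateOfAddv` (typed p253482; a theorem in print, not yet in the kernel), the
  same for every layer `k + 1 ≥ 1` (`Additive.mazurTate_norm_ratTwistedSymbolSum_pow_totient_eq_of_addv`).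
Scope (honest): the ANALYTIC side only (values of `θ_{k+1}` at characters; Birch's formula
`∑_a χ(a)[a/p^{k+1+e₀}]⁺_f = τ(χ)L(E, χ̄, 1)/Ω⁺_E` is MTT §I.8, not re-proved); nothing about BSD_p.
References: [Washington1997] §7.1–7.2; [MazurTateTeitelbaum1986Invent] §I.8, §I.12; [Pollack2003]
Prop. 6.9–6.10; [DoyonLei2021] Lemma 5.2, Cor. 5.3 [corpus: paper-arxiv-2103.06154 p0009];
[LeiPollackPratap2024] Thm 4.7 / 5.6 (their hypothesis `λ(θ_n) < p^{n−1}(p−1)` removed here); o6-r1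
GEN 3 `HOME/b2b-bsdres-o6-r1/gen3/O6-GEN3.md` §1 and `HOME/cells/o5o6/TARGETS.md` §O6 (G3-12) (b).
-/

set_option autoImplicit false

noncomputable section

open scoped Classical MatrixGroups ModularForm
open CongruenceSubgroup Polynomial WeierstrassCurve Literature.NumberTheory.EllipticCurves
  Literature.NumberTheory.EllipticCurves.ModularForms
  Literature.NumberTheory.EllipticCurves.Sprung2017
  Literature.NumberTheory.EllipticCurves.Rank1Residual
  Summit.BirchSwinnertonDyer.Rank1Residual.X1.MuLambda
  Summit.BirchSwinnertonDyer.Rank1Residual.Supersingular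

namespace Summit.BirchSwinnertonDyer.Rank1Residual.Iwasawa

variable {p : ℕ} [hp : Fact p.Prime]

/-! ## §1. `ω_m` in `Λ`: `μ = 0`, `λ = p^m`, value `(z+1)^{p^m} − 1`; `λ(polynomial) ≤ degree` -/
section Omega

/-- `red ω_m = T^{p^m} ≠ 0`. [folklore] -/
theorem red_toIwasawa_cyclotomicOmega_ne_zero (m : ℕ) :
    red (toIwasawa p (cyclotomicOmega p m)) ≠ 0 := by
  rw [red_toIwasawa_cyclotomicOmega]
  exact pow_ne_zero _ PowerSeries.X_ne_zero

/-- `ω_m ≠ 0` in `Λ`. [folklore] -/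
theorem toIwasawa_cyclotomicOmega_ne_zero (m : ℕ) : toIwasawa p (cyclotomicOmega p m) ≠ 0 := by
  intro h
  apply red_toIwasawa_cyclotomicOmega_ne_zero (p := p) m
  rw [h, red, map_zero]

/-- **`μ(ω_m) = 0` and `λ(ω_m) = p^m`** (`ω_m` is distinguished of degree `p^m`: `red ω_m = T^{p^m}`).
[cite: Washington1997, §7.1–7.2 and Thm. 7.3] -/
theorem mu_lam_toIwasawa_cyclotomicOmega (m : ℕ) :
    mu (toIwasawa p (cyclotomicOmega p m)) = 0 ∧ lam (toIwasawa p (cyclotomicOmega p m)) = p ^ m := by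
  obtain ⟨hmu, hlam⟩ :=
    mu_eq_zero_and_lam_eq_of_red_ne_zero (red_toIwasawa_cyclotomicOmega_ne_zero (p := p) m)
  refine ⟨hmu, ?_⟩
  rw [red_toIwasawa_cyclotomicOmega, PowerSeries.order_X_pow] at hlam
  exact_mod_cast hlam

/-- The value of `ω_m` at `z ∈ ℂ_p`: `∑_k ι([T^k]ω_m) z^k = (z + 1)^{p^m} − 1`. [folklore] -/
theorem hasSum_toIwasawa_cyclotomicOmega (m : ℕ) (z : ℂ_[p]) :
    HasSum (fun k ↦ ((algebraMap ℚ_[p] ℂ_[p]).comp (algebraMap ℤ_[p] ℚ_[p]))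
        (PowerSeries.coeff k (toIwasawa p (cyclotomicOmega p m))) * z ^ k)
      ((z + 1) ^ p ^ m - 1) := by
  have h := hasSum_map_coeff_coe_mul_pow ((algebraMap ℚ_[p] ℂ_[p]).comp (algebraMap ℤ_[p] ℚ_[p]))
    ((cyclotomicOmega p m).map (Int.castRingHom ℤ_[p])) z
  rw [Polynomial.eval₂_map, cyclotomicOmega, Polynomial.eval₂_sub, Polynomial.eval₂_pow,
    Polynomial.eval₂_add, Polynomial.eval₂_X, Polynomial.eval₂_one] at h
  rw [toIwasawa_apply]
  exact h

/-- **`λ` of a polynomial is at most its degree**: for `Q ∈ ℤ_p[T]` non-zero in `Λ`,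
`λ(Q) ≤ deg Q` (the reduction of `Q/p^{μ}` is a non-zero polynomial of degree `≤ deg Q`). [folklore] -/
theorem lam_coe_le_natDegree {Q : ℤ_[p][X]} (hQ : (Q : IwasawaAlgebra p) ≠ 0) :
    lam (Q : IwasawaAlgebra p) ≤ Q.natDegree := by
  set g : IwasawaAlgebra p := (Q : IwasawaAlgebra p) with hg
  by_contra hlt
  rw [not_le] at hlt
  have hfac := eq_C_pow_mu_mul_pfree g
  have hred0 : red (pfree g) ≠ 0 := red_pfree_ne_zero hQ
  -- `ord_T red(pfree g) = λ(g) > deg Q`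
  have hord : (red (pfree g)).order = (lam g : ℕ∞) := by
    rw [lam]
    exact (ENat.coe_toNat ((PowerSeries.order_finite_iff_ne_zero.mpr hred0).ne)).symm
  apply hred0
  ext j
  rw [map_zero]
  rcases lt_or_ge j (lam g) with hj | hj
  · exact PowerSeries.coeff_of_lt_order j (by rw [hord]; exact_mod_cast hj)
  · -- `j > deg Q`: the coefficient of `g` vanishes, hence that of `pfree g`
    have hjQ : Q.natDegree < j := lt_of_lt_of_le hlt hj
    have hcg : PowerSeries.coeff j g = 0 := by
      rw [hg, Polynomial.coeff_coe, Polynomial.coeff_eq_zero_of_natDegree_lt hjQ]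
    have hc : (p : ℤ_[p]) ^ mu g * PowerSeries.coeff j (pfree g) = 0 := by
      have := congrArg (PowerSeries.coeff j) hfac
      rw [PowerSeries.coeff_C_mul] at this
      rw [← this, hcg]
    have hpf : PowerSeries.coeff j (pfree g) = 0 :=
      (mul_eq_zero.mp hc).resolve_left (pow_ne_zero _ (by exact_mod_cast hp.out.ne_zero))
    rw [red, PowerSeries.coeff_map, hpf, map_zero]

end Omega

/-! ## §2. `|ζ^{p^m} − 1|^{φ(pⁿ⁺¹)} = p^{−p^m}` -/
section RootsOfUnity

/-- For `ζ` of order `pⁿ⁺¹` and `m ≤ n`, `ζ^{p^m}` has order `p^{(n−m)+1}`. [folklore] -/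
theorem isPrimitiveRoot_pow_prime_pow {n m : ℕ} (hmn : m ≤ n) {ζ : ℂ_[p]}
    (hζ : IsPrimitiveRoot ζ (p ^ (n + 1))) : IsPrimitiveRoot (ζ ^ p ^ m) (p ^ (n - m + 1)) :=
  hζ.pow (pow_pos hp.out.pos _) (by rw [← pow_add]; congr 1; omega)
/-- **`|ζ^{p^m} − 1|^{φ(pⁿ⁺¹)} = p^{−p^m}`** for `ζ ∈ ℂ_p` of order `pⁿ⁺¹`, `m ≤ n` (`ζ' = ζ^{p^m}` has
`|ζ' − 1|^{φ(p^{n−m+1})} = 1/p`, and `φ(pⁿ⁺¹) = p^m·φ(p^{n−m+1})`). [folklore] -/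
theorem norm_pow_prime_pow_sub_one_pow_totient_eq {n m : ℕ} (hmn : m ≤ n) {ζ : ℂ_[p]}
    (hζ : IsPrimitiveRoot ζ (p ^ (n + 1))) :
    ‖ζ ^ p ^ m - 1‖ ^ Nat.totient (p ^ (n + 1)) = ((p : ℝ)⁻¹) ^ p ^ m := by
  have h1 := norm_sub_one_pow_totient_eq (isPrimitiveRoot_pow_prime_pow hmn hζ)
  have hφ : Nat.totient (p ^ (n + 1)) = Nat.totient (p ^ (n - m + 1)) * p ^ m := by
    rw [Nat.totient_prime_pow_succ hp.out, Nat.totient_prime_pow_succ hp.out, mul_right_comm, ← pow_add,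
      Nat.sub_add_cancel hmn]
  rw [hφ, pow_mul, h1]

end RootsOfUnity

/-! ## §3. LEMMA A (kernel form): `G = ω_m · U` ⇒ `|G(ζ − 1)|^{φ(pⁿ⁺¹)} = p^{−(φ(pⁿ⁺¹)μ(G) + λ(G))}` -/
section LemmaA

/-- `μ(ω_m · U) = μ(U)` and `λ(ω_m · U) = p^m + λ(U)` for `U ≠ 0`. [cite: Washington1997, §7.1–7.2 and Thm. 7.3] -/
theorem mu_lam_omega_mul {U : IwasawaAlgebra p} (hU0 : U ≠ 0) (m : ℕ) :
    mu (toIwasawa p (cyclotomicOmega p m) * U) = mu U ∧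
      lam (toIwasawa p (cyclotomicOmega p m) * U) = p ^ m + lam U := by
  have hω0 := toIwasawa_cyclotomicOmega_ne_zero (p := p) m
  obtain ⟨hμω, hlω⟩ := mu_lam_toIwasawa_cyclotomicOmega (p := p) m
  exact ⟨by rw [mu_mul hω0 hU0, hμω, zero_add], by rw [lam_mul hω0 hU0, hlω]⟩

/-- **`|(ω_m U)(ζ − 1)| = |ζ^{p^m} − 1| · p^{−μ(U)} · |ζ − 1|^{λ(U)}`** for `ζ` of order `pⁿ⁺¹`,
`λ(U) < φ(pⁿ⁺¹)` (evaluation is multiplicative; the valuation theorem for `U`). [cite: Washington1997, §7.1–7.2 and Thm. 7.3] -/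
theorem norm_tsum_eq_of_eq_omega_mul {G U : IwasawaAlgebra p} {m n : ℕ}
    (hGU : G = toIwasawa p (cyclotomicOmega p m) * U) (hU0 : U ≠ 0) {ζ : ℂ_[p]}
    (hζ : IsPrimitiveRoot ζ (p ^ (n + 1))) (hlam : lam U < Nat.totient (p ^ (n + 1))) :
    ‖∑' k, ((algebraMap ℚ_[p] ℂ_[p]).comp (algebraMap ℤ_[p] ℚ_[p])) (PowerSeries.coeff k G) *
        (ζ - 1) ^ k‖ = ‖ζ ^ p ^ m - 1‖ * (((p : ℝ)⁻¹) ^ mu U * ‖ζ - 1‖ ^ lam U) := by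
  have hz := (norm_sub_one_pos_and_lt_one hζ).2
  have hbd : ∀ (A : PowerSeries ℤ_[p]) (k : ℕ),
      ‖((algebraMap ℚ_[p] ℂ_[p]).comp (algebraMap ℤ_[p] ℚ_[p])) (PowerSeries.coeff k A)‖ ≤ 1 :=
    norm_algebraMap_coeff_le_one
  rw [hGU, tsum_map_coeff_mul_mul_pow _ (hbd _) (hbd _) hz,
    (hasSum_toIwasawa_cyclotomicOmega m (ζ - 1)).tsum_eq, sub_add_cancel, norm_mul,
    norm_tsum_eq_of_lam_lt_totient hU0 hζ hlam]

/-- **LEMMA A (kernel form).** `G = ω_m · U` in `Λ`, `U ≠ 0`, `m ≤ n`, `ζ ∈ ℂ_p` of order `pⁿ⁺¹`,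
`λ(U) < φ(pⁿ⁺¹)`: **`|G(ζ − 1)|^{φ(pⁿ⁺¹)} = p^{−(φ(pⁿ⁺¹)·μ(G) + λ(G))}`** — the conclusion of the
tree's `norm_tsum_pow_totient_eq_of_lam_lt_totient` WITHOUT its hypothesis `λ(G) < φ(pⁿ⁺¹)` (here
`λ(G) = p^m + λ(U)` may reach `p^m + φ(pⁿ⁺¹) − 1`). O6-GEN3 §1. [cite: Washington1997, §7.1–7.2 and Thm. 7.3] -/
theorem norm_tsum_pow_totient_eq_of_eq_omega_mul {G U : IwasawaAlgebra p} {m n : ℕ}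
    (hGU : G = toIwasawa p (cyclotomicOmega p m) * U) (hU0 : U ≠ 0) (hmn : m ≤ n) {ζ : ℂ_[p]}
    (hζ : IsPrimitiveRoot ζ (p ^ (n + 1))) (hlam : lam U < Nat.totient (p ^ (n + 1))) :
    ‖∑' k, ((algebraMap ℚ_[p] ℂ_[p]).comp (algebraMap ℤ_[p] ℚ_[p])) (PowerSeries.coeff k G) *
        (ζ - 1) ^ k‖ ^ Nat.totient (p ^ (n + 1)) =
      ((p : ℝ)⁻¹) ^ (Nat.totient (p ^ (n + 1)) * mu G + lam G) := by
  obtain ⟨hμ, hlG⟩ := mu_lam_omega_mul hU0 m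
  rw [norm_tsum_eq_of_eq_omega_mul hGU hU0 hζ hlam, mul_pow, mul_pow,
    norm_pow_prime_pow_sub_one_pow_totient_eq hmn hζ, ← pow_mul,
    show (‖ζ - 1‖ ^ lam U) ^ Nat.totient (p ^ (n + 1)) =
        (‖ζ - 1‖ ^ Nat.totient (p ^ (n + 1))) ^ lam U by rw [← pow_mul, ← pow_mul, mul_comm],
    norm_sub_one_pow_totient_eq hζ, ← pow_add, ← pow_add, hGU, hμ, hlG]
  congr 1
  ring

/-- **LEMMA A with the hypothesis on `λ(G)`**: `G = ω_m · U ≠ 0`, `m ≤ n`, `λ(G) < p^m + φ(pⁿ⁺¹)`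
⇒ `|G(ζ − 1)|^{φ(pⁿ⁺¹)} = p^{−(φ(pⁿ⁺¹)·μ(G) + λ(G))}`. [cite: Washington1997, §7.1–7.2 and Thm. 7.3] -/
theorem norm_tsum_pow_totient_eq_of_eq_omega_mul_of_lam_lt {G U : IwasawaAlgebra p} {m n : ℕ}
    (hGU : G = toIwasawa p (cyclotomicOmega p m) * U) (hG0 : G ≠ 0) (hmn : m ≤ n) {ζ : ℂ_[p]}
    (hζ : IsPrimitiveRoot ζ (p ^ (n + 1))) (hlam : lam G < p ^ m + Nat.totient (p ^ (n + 1))) :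
    ‖∑' k, ((algebraMap ℚ_[p] ℂ_[p]).comp (algebraMap ℤ_[p] ℚ_[p])) (PowerSeries.coeff k G) *
        (ζ - 1) ^ k‖ ^ Nat.totient (p ^ (n + 1)) =
      ((p : ℝ)⁻¹) ^ (Nat.totient (p ^ (n + 1)) * mu G + lam G) := by
  have hU0 : U ≠ 0 := by rintro rfl; exact hG0 (by rw [hGU, mul_zero])
  have hlG := (mu_lam_omega_mul hU0 m).2
  rw [← hGU] at hlG
  exact norm_tsum_pow_totient_eq_of_eq_omega_mul hGU hU0 hmn hζ (by omega)

end LemmaA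

/-! ## §4. Mazur–Tate elements divisible by `ω_k`: the Birch sums read `(μ, λ)` exactly -/
section MazurTate

variable {N : ℕ} {f : CuspForm (Gamma0 N) 2}

/-- `ω_k ∈ ℤ_p[T]` is monic of degree `pᵏ`. [folklore] -/
theorem monic_map_cyclotomicOmega (k : ℕ) :
    ((cyclotomicOmega p k).map (Int.castRingHom ℤ_[p])).Monic ∧
      ((cyclotomicOmega p k).map (Int.castRingHom ℤ_[p])).natDegree = p ^ k := by
  have hmon : (cyclotomicOmega p k).Monic := by
    rw [cyclotomicOmega, ← C_1]
    refine Polynomial.Monic.sub_of_left ((Polynomial.monic_X_add_C (1 : ℤ)).pow _) ?_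
    rw [Polynomial.degree_C (one_ne_zero' ℤ), Polynomial.degree_pow, Polynomial.degree_X_add_C,
      nsmul_one]
    exact_mod_cast pow_pos hp.out.pos k
  have hdeg : (cyclotomicOmega p k).natDegree = p ^ k := by
    have h1 : ((X + 1 : ℤ[X]) ^ p ^ k).natDegree = p ^ k := by
      rw [← C_1, Polynomial.natDegree_pow_X_add_C]
    rw [cyclotomicOmega, Polynomial.natDegree_sub_eq_left_of_natDegree_lt] <;> rw [h1]
    simp [hp.out.pos]
  exact ⟨hmon.map _, by rw [hmon.natDegree_map, hdeg]⟩

/-- **An integral model of `θ_{k+1}` divisible by `ω_k` factors as `ω_k · U` in `Λ` with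
`λ(U) < φ(pᵏ⁺¹)`**: `Θ` is a polynomial of degree `< pᵏ⁺¹`; `ω_k ∣ θ_{k+1}` passes to `ℚ_p[T]` and,
`ω_k` being monic, descends to `ℤ_p[T]` (`Polynomial.map_dvd_map`); `deg U < φ(pᵏ⁺¹)`, `λ ≤ deg`.
[cite: Pollack2003, Def. 6.15 and Remark 6.16] [cite: DoyonLei2021, Lemma 5.2 and Cor. 5.3] -/
theorem exists_eq_omega_mul_of_omega_dvd_mazurTate {k : ℕ} {Θ : IwasawaAlgebra p}
    (hΘ : iwasawaToPowerSeries p Θ =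
      ((mazurTateElement f p (k + 1)).map (algebraMap ℚ ℚ_[p]) : PowerSeries ℚ_[p]))
    (hΘ0 : Θ ≠ 0) (hω : (cyclotomicOmega p k).map (Int.castRingHom ℚ) ∣ mazurTateElement f p (k + 1)) :
    ∃ U : IwasawaAlgebra p, Θ = toIwasawa p (cyclotomicOmega p k) * U ∧ U ≠ 0 ∧
      lam U < Nat.totient (p ^ (k + 1)) := by
  -- `Θ` is the polynomial `P := trunc_{p^{k+1}} Θ`
  set P : ℤ_[p][X] := PowerSeries.trunc (p ^ (k + 1)) Θ with hP
  have hPΘ : (P : IwasawaAlgebra p) = Θ := by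
    ext i
    rw [Polynomial.coeff_coe, hP, PowerSeries.coeff_trunc]
    split_ifs with hi
    · rfl
    · exact (coeff_eq_zero_of_iwasawaToPowerSeries_eq hΘ (not_lt.mp hi)).symm
  -- `P ↦ θ_{k+1}` under `ℤ_p[T] → ℚ_p[T]`
  have hPmap : P.map (algebraMap ℤ_[p] ℚ_[p]) = (mazurTateElement f p (k + 1)).map (algebraMap ℚ ℚ_[p]) := by
    ext i
    have h := congrArg (PowerSeries.coeff i) hΘ
    rw [iwasawaToPowerSeries, PowerSeries.coeff_map, Polynomial.coeff_coe] at h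
    rw [Polynomial.coeff_map, ← h, ← hPΘ, Polynomial.coeff_coe]
  -- the divisibility in `ℚ_p[T]`, then in `ℤ_p[T]` (monic divisor)
  obtain ⟨hmon, hdeg⟩ := monic_map_cyclotomicOmega (p := p) k
  have hdvdQ : ((cyclotomicOmega p k).map (Int.castRingHom ℤ_[p])).map (algebraMap ℤ_[p] ℚ_[p]) ∣
      P.map (algebraMap ℤ_[p] ℚ_[p]) := by
    rw [hPmap, Polynomial.map_map, RingHom.ext_int ((algebraMap ℤ_[p] ℚ_[p]).comp (Int.castRingHom ℤ_[p]))
      ((algebraMap ℚ ℚ_[p]).comp (Int.castRingHom ℚ)), ← Polynomial.map_map]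
    exact Polynomial.map_dvd _ hω
  have hdvd : (cyclotomicOmega p k).map (Int.castRingHom ℤ_[p]) ∣ P :=
    (Polynomial.map_dvd_map _ (IsFractionRing.injective ℤ_[p] ℚ_[p]) hmon).mp hdvdQ
  obtain ⟨Q, hPQ⟩ := hdvd
  refine ⟨(Q : IwasawaAlgebra p), ?_, ?_, ?_⟩
  · rw [← hPΘ, hPQ, Polynomial.coe_mul, toIwasawa_apply]
  · intro hQ0
    apply hΘ0
    rw [← hPΘ, hPQ, Polynomial.coe_mul, hQ0, mul_zero]
  · -- degrees: `deg P < p^{k+1}`, `deg P = p^k + deg Q`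
    have hQ0 : Q ≠ 0 := by
      rintro rfl
      apply hΘ0
      rw [← hPΘ, hPQ, mul_zero, Polynomial.coe_zero]
    have hQ0' : (Q : IwasawaAlgebra p) ≠ 0 := fun h ↦ hQ0 (Polynomial.coe_eq_zero_iff.mp h)
    have hP0 : P ≠ 0 := by rw [hPQ]; exact mul_ne_zero hmon.ne_zero hQ0
    have hdegP : P.natDegree < p ^ (k + 1) := by
      have h := PowerSeries.degree_trunc_lt Θ (p ^ (k + 1))
      rw [← hP] at h
      exact (Polynomial.natDegree_lt_iff_degree_lt hP0).mpr h
    have hdegPQ : P.natDegree = p ^ k + Q.natDegree := by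
      rw [hPQ, Polynomial.natDegree_mul hmon.ne_zero hQ0, hdeg]
    have hφ : Nat.totient (p ^ (k + 1)) + p ^ k = p ^ (k + 1) := by
      rw [Nat.totient_prime_pow_succ hp.out, ← mul_add_one, Nat.sub_add_cancel hp.out.one_le, pow_succ]
    have hle := lam_coe_le_natDegree hQ0'
    omega

/-- **LEMMA A for Mazur–Tate elements (`ordChi_mazurTate_eq_of_omegaDvd`, o6-r1 GEN 3 O6-GEN3 §1 /
TARGETS (G3-12) (b)).** `Θ ≠ 0` an integral model of `θ_{k+1}` (`ι Θ = θ_{k+1}`) with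
`ω_k ∣ θ_{k+1}` in `ℚ[T]` (as at every ADDITIVE prime, Doyon–Lei); `χ` a primitive even
`p`-power-order character mod `p^{k+1+e₀}` with values in `ℂ_p` (so `χ(γ)` has order `pᵏ⁺¹` and
`Θ(χ(γ) − 1) = ∑_a χ(a)[a/p^{k+1+e₀}]⁺_f`). Then, with NO hypothesis on `λ(Θ)`:
**`|∑_a χ(a)[a/p^{k+1+e₀}]⁺_f|^{φ(pᵏ⁺¹)} = p^{−(φ(pᵏ⁺¹)·μ(Θ) + λ(Θ))}`**, i.e.
`ord_p χ(θ_{k+1}) = μ(θ_{k+1}) + λ(θ_{k+1})/φ(pᵏ⁺¹)` — the valuation of the field norm of the Birch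
sum is `φ(pᵏ⁺¹)μ + λ` EXACTLY (o6-r1's `A_k = μ_k φ(3^k) + λ_k`). Compare the tree's
`mazurTate_norm_ratTwistedSymbolSum_pow_totient_eq_of_lam_lt_totient` (hypothesis `λ(Θ) < φ(pᵏ⁺¹)`,
which FAILS as a rule at additive primes).
[cite: MazurTateTeitelbaum1986Invent, §I.8 and §I.12] [cite: DoyonLei2021, Lemma 5.2 and Cor. 5.3]
[cite: Washington1997, §7.1–7.2 and Thm. 7.3] -/
theorem mazurTate_norm_ratTwistedSymbolSum_pow_totient_eq_of_omega_dvd {k : ℕ} {Θ : IwasawaAlgebra p}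
    (hΘ : iwasawaToPowerSeries p Θ =
      ((mazurTateElement f p (k + 1)).map (algebraMap ℚ ℚ_[p]) : PowerSeries ℚ_[p]))
    (hΘ0 : Θ ≠ 0) (hω : (cyclotomicOmega p k).map (Int.castRingHom ℚ) ∣ mazurTateElement f p (k + 1))
    (χ : DirichletCharacter ℂ_[p] (p ^ (k + 1 + cyclotomicExponent p)))
    (hχ : χ.IsPrimitive) (hev : χ.Even) (hord : ∃ j : ℕ, orderOf χ = p ^ j) :
    ‖ratTwistedSymbolSum f χ‖ ^ Nat.totient (p ^ (k + 1)) =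
      ((p : ℝ)⁻¹) ^ (Nat.totient (p ^ (k + 1)) * mu Θ + lam Θ) := by
  obtain ⟨U, hΘU, hU0, hlamU⟩ := exists_eq_omega_mul_of_omega_dvd_mazurTate hΘ hΘ0 hω
  rw [← (hasSum_mazurTate_eq_ratTwistedSymbolSum hΘ χ hev hord).tsum_eq]
  exact norm_tsum_pow_totient_eq_of_eq_omega_mul hΘU hU0 le_rfl
    (isPrimitiveRoot_apply_cyclotomicGenerator χ hχ hev hord) hlamU

/-- **The `μ = 0` reading** (census form `A_k = λ_k`): `|∑_a χ(a)[a/p^{k+1+e₀}]⁺_f|^{φ(pᵏ⁺¹)} = p^{−λ(Θ)}`.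
[cite: MazurTateTeitelbaum1986Invent, §I.8 and §I.12] [cite: DoyonLei2021, Lemma 5.2 and Cor. 5.3] -/
theorem mazurTate_norm_ratTwistedSymbolSum_pow_totient_eq_of_omega_dvd_of_mu_eq_zero {k : ℕ}
    {Θ : IwasawaAlgebra p}
    (hΘ : iwasawaToPowerSeries p Θ =
      ((mazurTateElement f p (k + 1)).map (algebraMap ℚ ℚ_[p]) : PowerSeries ℚ_[p]))
    (hΘ0 : Θ ≠ 0) (hω : (cyclotomicOmega p k).map (Int.castRingHom ℚ) ∣ mazurTateElement f p (k + 1))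
    (hμ : mu Θ = 0) (χ : DirichletCharacter ℂ_[p] (p ^ (k + 1 + cyclotomicExponent p)))
    (hχ : χ.IsPrimitive) (hev : χ.Even) (hord : ∃ j : ℕ, orderOf χ = p ^ j) :
    ‖ratTwistedSymbolSum f χ‖ ^ Nat.totient (p ^ (k + 1)) = ((p : ℝ)⁻¹) ^ lam Θ := by
  rw [mazurTate_norm_ratTwistedSymbolSum_pow_totient_eq_of_omega_dvd hΘ hΘ0 hω χ hχ hev hord, hμ,
    mul_zero, zero_add]

/-- **`λ(θ_{k+1}) ≥ pᵏ` whenever `ω_k ∣ θ_{k+1}`** (Doyon–Lei Cor. 5.3's inequality, kernel form: for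
an integral model `Θ ≠ 0`, `λ(Θ) = pᵏ + λ(U) ≥ pᵏ`). [cite: DoyonLei2021, Lemma 5.2 and Cor. 5.3] -/
theorem prime_pow_le_lam_mazurTate_of_omega_dvd {k : ℕ} {Θ : IwasawaAlgebra p}
    (hΘ : iwasawaToPowerSeries p Θ =
      ((mazurTateElement f p (k + 1)).map (algebraMap ℚ ℚ_[p]) : PowerSeries ℚ_[p]))
    (hΘ0 : Θ ≠ 0) (hω : (cyclotomicOmega p k).map (Int.castRingHom ℚ) ∣ mazurTateElement f p (k + 1)) :
    p ^ k ≤ lam Θ ∧ lam Θ < p ^ k + Nat.totient (p ^ (k + 1)) := by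
  obtain ⟨U, hΘU, hU0, hlamU⟩ := exists_eq_omega_mul_of_omega_dvd_mazurTate hΘ hΘ0 hω
  have hlG := (mu_lam_omega_mul hU0 k).2
  rw [← hΘU] at hlG
  omega

end MazurTate

end Summit.BirchSwinnertonDyer.Rank1Residual.Iwasawa

/-! ## §5. At an ADDITIVE prime of `E`: every layer, granted the Doyon–Lei node -/

namespace Summit.BirchSwinnertonDyer.Rank1Residual.Additive

open Summit.BirchSwinnertonDyer.Rank1Residual.Iwasawa

/-- **At an additive prime the Birch sums of EVERY layer read `(μ, λ)(θ_{k+1})` exactly**: `Addv W p`,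
`f` the newform of `W`, granted `OmegaDvdMazurTateOfAddv` (Doyon–Lei Lemma 5.2 / Cor. 5.3, typed
p253482): for every `k`, integral model `Θ ≠ 0` of `θ_{k+1}` and primitive even `p`-power-order `χ` of
conductor `p^{k+1+e₀}`, `|∑_a χ(a)[a/p^{k+1+e₀}]⁺_f|^{φ(pᵏ⁺¹)} = p^{−(φ(pᵏ⁺¹)·μ(Θ) + λ(Θ))}` —
o6-r1's "λ is the BSD observable at additive 3" (O6-GEN3 §1), for every `p`.
[cite: DoyonLei2021, Lemma 5.2 and Cor. 5.3] [cite: MazurTateTeitelbaum1986Invent, §I.8 and §I.12] -/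
theorem mazurTate_norm_ratTwistedSymbolSum_pow_totient_eq_of_addv (h : OmegaDvdMazurTateOfAddv)
    (W : WeierstrassCurve ℚ) [W.IsElliptic] [W.IsGloballyMinimal] [NeZero (W.conductorNorm ℤ)]
    (f : CuspForm (Gamma0 (W.conductorNorm ℤ)) 2) (p : ℕ) [Fact p.Prime] (hf : IsNewformOf W f)
    (hadd : Addv W p) {k : ℕ} {Θ : IwasawaAlgebra p}
    (hΘ : iwasawaToPowerSeries p Θ =
      ((mazurTateElement f p (k + 1)).map (algebraMap ℚ ℚ_[p]) : PowerSeries ℚ_[p]))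
    (hΘ0 : Θ ≠ 0) (χ : DirichletCharacter ℂ_[p] (p ^ (k + 1 + cyclotomicExponent p)))
    (hχ : χ.IsPrimitive) (hev : χ.Even) (hord : ∃ j : ℕ, orderOf χ = p ^ j) :
    ‖ratTwistedSymbolSum f χ‖ ^ Nat.totient (p ^ (k + 1)) =
      ((p : ℝ)⁻¹) ^ (Nat.totient (p ^ (k + 1)) * mu Θ + lam Θ) :=
  mazurTate_norm_ratTwistedSymbolSum_pow_totient_eq_of_omega_dvd hΘ hΘ0
    (by simpa using h W f p hf hadd (k + 1) (Nat.succ_pos k)) χ hχ hev hord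

/-- **`pᵏ ≤ λ(θ_{k+1}) < pᵏ + φ(pᵏ⁺¹)` at an additive prime** (Doyon–Lei Cor. 5.3 in the kernel,
granted the node; upper bound from `deg θ_{k+1} < pᵏ⁺¹`). [cite: DoyonLei2021, Lemma 5.2 and Cor. 5.3] -/
theorem prime_pow_le_lam_mazurTate_of_addv (h : OmegaDvdMazurTateOfAddv)
    (W : WeierstrassCurve ℚ) [W.IsElliptic] [W.IsGloballyMinimal] [NeZero (W.conductorNorm ℤ)]
    (f : CuspForm (Gamma0 (W.conductorNorm ℤ)) 2) (p : ℕ) [Fact p.Prime] (hf : IsNewformOf W f)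
    (hadd : Addv W p) {k : ℕ} {Θ : IwasawaAlgebra p}
    (hΘ : iwasawaToPowerSeries p Θ =
      ((mazurTateElement f p (k + 1)).map (algebraMap ℚ ℚ_[p]) : PowerSeries ℚ_[p]))
    (hΘ0 : Θ ≠ 0) : p ^ k ≤ lam Θ ∧ lam Θ < p ^ k + Nat.totient (p ^ (k + 1)) :=
  prime_pow_le_lam_mazurTate_of_omega_dvd hΘ hΘ0
    (by simpa using h W f p hf hadd (k + 1) (Nat.succ_pos k))

end Summit.BirchSwinnertonDyer.Rank1Residual.Additive

end
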